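import Mathlib.Analysis.SpecialFunctions.Pow.Real
import Mathlib.Tactic.Linarith
import Mathlib.Tactic.Positivity
import Mathlib.Tactic.Ring
import Mathlib.Tactic.FieldSimp
import Summits.CriticalPhenomena.PercolationContinuityZ3.Theorems.PercNearOneGluingNoHeavyLowerTailAPLConjFUnion
import HarnessLib

/-!
# `NoHeavyLowerTail` (stmt-CriticalPhenomena-4575) — CONJECTURE F under apex piece-union: cell form of the mixed-leaning lemma

Support file (prover prim-ineq-gen-8 gen 35; `--supports stmt-CriticalPhenomena-4575`; memo
run/shared/lean/prim/prim-ineq-gen-8/FINDING-gen35-CONJF-UNION.md).  Pure real algebra: no definitions, no named facts, no sorries.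

`…APLConjFUnion.lean` proves the mixed-leaning union lemma for the `F_c`-slack in normalised gadget coordinates
(`conjF_c_union_mixed_norm`).  This file adds
* `conjF_b_union_mixed_norm` — the `F_b`-slack of the same union (b-leaning `u` with `ubc ≥ e_u`, c-leaning `v` with `F_b`),
  by the `b ↔ c` mirror composed with the `u ↔ v` swap;
* `conjF_c_union_mixed` — the CELL form used by the forest induction (memo FINDING-gen34-CONJF.md §2): for nonnegative cell
  vectors `u = (u0,uab,uac,ubc,u3)` (b-leaning, `u0 ≥ uab+uac`, Harris, APL-G `(T·D − e·S)² ≤ uab·uac·S²`, `F_c`) and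
  `v` (c-leaning, `v0 ≥ vab+vac`, `vbc ≥ vab+vac`, Harris, APL-G) the apex piece-union
  `w0 = u0v0, wab = u0vab+uab·v0+uab·vab, wac = u0vac+uac·v0+uac·vac, wbc = u0vbc+ubc·v0+ubc·vbc, w3 = rest`
  satisfies `F_c(w) = 3e_wS_w − D_w(3wab + wac + 2w3) ≥ 0`; the bridge is the identity `F_c(w) = D_uD_vS_uS_v·Φ` (`field_simp; ring`).
Together with gen 34's `conjF_c_union_of_light` (LEMMA N), `conjF_c_union_abEdge` (LEMMA E) and the certificate-verified aligned /
`u0 ≤ e` / `ubc ≤ e` leaves (memo gen 34 §3), this completes LEMMA U″ and hence THEOREM F_T of the memo (F on forests).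
[folklore algebra]
-/

namespace Summit.CriticalPhenomena.PercolationContinuityZ3.Theorems

namespace APL

/-- **Mixed-leaning leaf, target `F_b`** (normalised gadget coordinates): b-leaning `u = (D,x,y,r)` with `x+y ≤ 1/2`, Harris,
APL-G and `D ≤ 1 − r` (`ubc ≥ e_u`); c-leaning `v = (D',x',y',r')` with `x'+y' ≤ 1/2`, Harris, APL-G and
`F_b : 2r' ≤ 3(x'+y') − D'(y'−x')`.  Then the `F_b`-slack `(1 − (xy'+yx'))(1 + 2(1−r)(1−r') + DD'M) − 3(1−x−y)(1−x'−y') ≥ 0`.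
Proof: `conjF_c_union_mixed_norm` applied to the mirrored, swapped pair. [folklore] -/
theorem conjF_b_union_mixed_norm (D x y r D' x' y' r' : ℝ)
    (hy : 0 ≤ y) (hyx : y ≤ x) (hQ : x + y ≤ 1/2) (hD : 0 ≤ D)
    (hl : x + y ≤ r) (hg : (r - x - y)^2 ≤ x*y) (hbc : D ≤ 1 - r)
    (hx' : 0 ≤ x') (hxy' : x' ≤ y') (hQ' : x' + y' ≤ 1/2) (hD' : 0 ≤ D')
    (hl' : x' + y' ≤ r') (hg' : (r' - x' - y')^2 ≤ x'*y') (hF' : 2*r' ≤ 3*(x'+y') - D'*(y'-x')) :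
    0 ≤ (1 - (x*y' + y*x')) * (1 + 2*(1-r)*(1-r')
          + D*D'*((x-y)*(1-(x'+y')/2) - (y'-x')*(1-(x+y)/2)))
        - 3*(1-(x+y))*(1-(x'+y')) := by
  have hgs' : (r' - y' - x')^2 ≤ y'*x' := by
    have e1 : r' - y' - x' = r' - x' - y' := by ring
    rw [e1, mul_comm]; exact hg'
  have hgs : (r - y - x)^2 ≤ y*x := by
    have e1 : r - y - x = r - x - y := by ring
    rw [e1, mul_comm]; exact hg
  have h := conjF_c_union_mixed_norm D' y' x' r' D y x r hx' hxy' (by linarith) hD' (by linarith) hgs'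
    (by linarith) hy hyx (by linarith) hD (by linarith) hgs hbc
  have e : (1 - (x*y' + y*x')) * (1 + 2*(1-r)*(1-r')
          + D*D'*((x-y)*(1-(x'+y')/2) - (y'-x')*(1-(x+y)/2)))
        - 3*(1-(x+y))*(1-(x'+y'))
      = (1 - (y'*x + x'*y)) * (1 + 2*(1-r')*(1-r)
          - D'*D*((y'-x')*(1-(y+x)/2) - (x-y)*(1-(y'+x')/2)))
        - 3*(1-(y'+x'))*(1-(y+x)) := by ring
  rw [e]; exact h

set_option maxHeartbeats 1600000 in
/-- **LEMMA U″ (mixed-leaning leaf) in cells.**  `u = (u0,uab,uac,ubc,u3) ≥ 0` b-leaning (`uac ≤ uab`) with `uab+uac ≤ u0`,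
Harris `e_uS_u ≤ T_uD_u`, APL-G `(T_uD_u − e_uS_u)² ≤ uab·uac·S_u²` and `F_c(u) ≥ 0`; `v ≥ 0` c-leaning (`vab ≤ vac`) with
`vab+vac ≤ v0`, `vab+vac ≤ vbc`, Harris and APL-G.  Then the apex piece-union `w` satisfies `F_c(w) ≥ 0`.
(`e = uab+uac`, `D = u0+e`, `T = e+u3`, `S` = total mass.)  GZ (5.1) and `F(v)` are not needed. [folklore] -/
theorem conjF_c_union_mixed (u0 uab uac ubc u3 v0 vab vac vbc v3 : ℝ)
    (hu0 : 0 ≤ u0) (huab : 0 ≤ uab) (huac : 0 ≤ uac) (hubc : 0 ≤ ubc) (hu3 : 0 ≤ u3)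
    (hv0 : 0 ≤ v0) (hvab : 0 ≤ vab) (hvac : 0 ≤ vac) (hvbc : 0 ≤ vbc) (hv3 : 0 ≤ v3)
    (hub : uac ≤ uab) (hue : uab + uac ≤ u0)
    (hHu : (uab+uac)*(u0+uab+uac+ubc+u3) ≤ (uab+uac+u3)*(u0+uab+uac))
    (hGu : ((uab+uac+u3)*(u0+uab+uac) - (uab+uac)*(u0+uab+uac+ubc+u3))^2 ≤ uab*uac*(u0+uab+uac+ubc+u3)^2)
    (hFC : 0 ≤ 3*(uab+uac)*(u0+uab+uac+ubc+u3) - (u0+uab+uac)*(3*uab+uac+2*u3))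
    (hvc : vab ≤ vac) (hve : vab + vac ≤ v0) (hvbce : vab + vac ≤ vbc)
    (hHv : (vab+vac)*(v0+vab+vac+vbc+v3) ≤ (vab+vac+v3)*(v0+vab+vac))
    (hGv : ((vab+vac+v3)*(v0+vab+vac) - (vab+vac)*(v0+vab+vac+vbc+v3))^2 ≤ vab*vac*(v0+vab+vac+vbc+v3)^2) :
    0 ≤ 3*((u0*vab+uab*v0+uab*vab)+(u0*vac+uac*v0+uac*vac))*(u0*v0+(u0*vab+uab*v0+uab*vab)+(u0*vac+uac*v0+uac*vac)+(u0*vbc+ubc*v0+ubc*vbc)+(u3*(v0+vab+vac+vbc+v3)+(u0+uab+uac+ubc+u3)*v3-u3*v3+uab*(vac+vbc)+uac*(vab+vbc)+ubc*(vab+vac))) - (u0*v0+(u0*vab+uab*v0+uab*vab)+(u0*vac+uac*v0+uac*vac))*(3*(u0*vab+uab*v0+uab*vab)+(u0*vac+uac*v0+uac*vac)+2*(u3*(v0+vab+vac+vbc+v3)+(u0+uab+uac+ubc+u3)*v3-u3*v3+uab*(vac+vbc)+uac*(vab+vbc)+ubc*(vab+vac))) := by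
  -- the polynomial identity  F_c(w) = (D_uD_v − (uab vac + uac vab))·(S_uS_v + 2A_uA_v − N) − 3u0v0S_uS_v
  have poly : 3*((u0*vab+uab*v0+uab*vab)+(u0*vac+uac*v0+uac*vac))*(u0*v0+(u0*vab+uab*v0+uab*vab)+(u0*vac+uac*v0+uac*vac)+(u0*vbc+ubc*v0+ubc*vbc)+(u3*(v0+vab+vac+vbc+v3)+(u0+uab+uac+ubc+u3)*v3-u3*v3+uab*(vac+vbc)+uac*(vab+vbc)+ubc*(vab+vac))) - (u0*v0+(u0*vab+uab*v0+uab*vab)+(u0*vac+uac*v0+uac*vac))*(3*(u0*vab+uab*v0+uab*vab)+(u0*vac+uac*v0+uac*vac)+2*(u3*(v0+vab+vac+vbc+v3)+(u0+uab+uac+ubc+u3)*v3-u3*v3+uab*(vac+vbc)+uac*(vab+vbc)+ubc*(vab+vac)))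
      = ((u0+uab+uac)*(v0+vab+vac) - (uab*vac+uac*vab))
          * ((u0+uab+uac+ubc+u3)*(v0+vab+vac+vbc+v3) + 2*(u0+ubc)*(v0+vbc)
              - ((uab-uac)*((v0+vab+vac) - (vab+vac)/2) - (vac-vab)*((u0+uab+uac) - (uab+uac)/2)))
        - 3*u0*v0*(u0+uab+uac+ubc+u3)*(v0+vab+vac+vbc+v3) := by
    ring
  rw [poly]
  -- degenerate pieces
  rcases eq_or_lt_of_le (show 0 ≤ u0+uab+uac by positivity) with hDu | hDu
  · have e0 : u0 = 0 := by linarith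
    have e1 : uab = 0 := by linarith
    have e2 : uac = 0 := by linarith
    subst e0 e1 e2
    norm_num
  rcases eq_or_lt_of_le (show 0 ≤ v0+vab+vac by positivity) with hDv | hDv
  · have e0 : v0 = 0 := by linarith
    have e1 : vab = 0 := by linarith
    have e2 : vac = 0 := by linarith
    subst e0 e1 e2
    norm_num
  -- generic case: normalise and apply the gadget-coordinate lemma
  have hSu : 0 < u0+uab+uac+ubc+u3 := by linarith
  have hSv : 0 < v0+vab+vac+vbc+v3 := by linarith
  have hDu0 : u0+uab+uac ≠ 0 := ne_of_gt hDu
  have hDv0 : v0+vab+vac ≠ 0 := ne_of_gt hDv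
  have hSu0 : u0+uab+uac+ubc+u3 ≠ 0 := ne_of_gt hSu
  have hSv0 : v0+vab+vac+vbc+v3 ≠ 0 := ne_of_gt hSv
  have h_y : 0 ≤ uac/(u0+uab+uac) := div_nonneg huac hDu.le
  have h_yx : uac/(u0+uab+uac) ≤ uab/(u0+uab+uac) := div_le_div_of_nonneg_right hub hDu.le
  have h_Q : uab/(u0+uab+uac) + uac/(u0+uab+uac) ≤ 1/2 := by
    rw [← add_div, div_le_iff₀ hDu]; linarith
  have h_D : 0 ≤ (u0+uab+uac)/(u0+uab+uac+ubc+u3) := div_nonneg hDu.le hSu.le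
  have h_l : uab/(u0+uab+uac) + uac/(u0+uab+uac) ≤ (uab+uac+u3)/(u0+uab+uac+ubc+u3) := by
    rw [← add_div, div_le_iff₀ hDu, div_mul_eq_mul_div, le_div_iff₀ hSu]; linarith
  have h_g : ((uab+uac+u3)/(u0+uab+uac+ubc+u3) - uab/(u0+uab+uac) - uac/(u0+uab+uac))^2
      ≤ uab/(u0+uab+uac) * (uac/(u0+uab+uac)) := by
    have e1 : (uab+uac+u3)/(u0+uab+uac+ubc+u3) - uab/(u0+uab+uac) - uac/(u0+uab+uac)
        = ((uab+uac+u3)*(u0+uab+uac) - (uab+uac)*(u0+uab+uac+ubc+u3)) / ((u0+uab+uac+ubc+u3)*(u0+uab+uac)) := by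
      field_simp; ring
    have e2 : uab/(u0+uab+uac) * (uac/(u0+uab+uac))
        = (uab*uac*(u0+uab+uac+ubc+u3)^2) / ((u0+uab+uac+ubc+u3)*(u0+uab+uac))^2 := by
      field_simp
    rw [e1, e2, div_pow]
    exact div_le_div_of_nonneg_right hGu (by positivity)
  have h_F : 2*((uab+uac+u3)/(u0+uab+uac+ubc+u3)) ≤ 3*(uab/(u0+uab+uac) + uac/(u0+uab+uac))
      - (u0+uab+uac)/(u0+uab+uac+ubc+u3) * (uab/(u0+uab+uac) - uac/(u0+uab+uac)) := by
    have e1 : 3*(uab/(u0+uab+uac) + uac/(u0+uab+uac))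
        - (u0+uab+uac)/(u0+uab+uac+ubc+u3) * (uab/(u0+uab+uac) - uac/(u0+uab+uac))
        - 2*((uab+uac+u3)/(u0+uab+uac+ubc+u3))
        = (3*(uab+uac)*(u0+uab+uac+ubc+u3) - (u0+uab+uac)*(3*uab+uac+2*u3)) / ((u0+uab+uac)*(u0+uab+uac+ubc+u3)) := by
      field_simp; ring
    have : 0 ≤ 3*(uab/(u0+uab+uac) + uac/(u0+uab+uac))
        - (u0+uab+uac)/(u0+uab+uac+ubc+u3) * (uab/(u0+uab+uac) - uac/(u0+uab+uac))
        - 2*((uab+uac+u3)/(u0+uab+uac+ubc+u3)) := by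
      rw [e1]; exact div_nonneg hFC (by positivity)
    linarith
  have h_x' : 0 ≤ vab/(v0+vab+vac) := div_nonneg hvab hDv.le
  have h_xy' : vab/(v0+vab+vac) ≤ vac/(v0+vab+vac) := div_le_div_of_nonneg_right hvc hDv.le
  have h_Q' : vab/(v0+vab+vac) + vac/(v0+vab+vac) ≤ 1/2 := by
    rw [← add_div, div_le_iff₀ hDv]; linarith
  have h_D' : 0 ≤ (v0+vab+vac)/(v0+vab+vac+vbc+v3) := div_nonneg hDv.le hSv.le
  have h_l' : vab/(v0+vab+vac) + vac/(v0+vab+vac) ≤ (vab+vac+v3)/(v0+vab+vac+vbc+v3) := by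
    rw [← add_div, div_le_iff₀ hDv, div_mul_eq_mul_div, le_div_iff₀ hSv]; linarith
  have h_g' : ((vab+vac+v3)/(v0+vab+vac+vbc+v3) - vab/(v0+vab+vac) - vac/(v0+vab+vac))^2
      ≤ vab/(v0+vab+vac) * (vac/(v0+vab+vac)) := by
    have e1 : (vab+vac+v3)/(v0+vab+vac+vbc+v3) - vab/(v0+vab+vac) - vac/(v0+vab+vac)
        = ((vab+vac+v3)*(v0+vab+vac) - (vab+vac)*(v0+vab+vac+vbc+v3)) / ((v0+vab+vac+vbc+v3)*(v0+vab+vac)) := by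
      field_simp; ring
    have e2 : vab/(v0+vab+vac) * (vac/(v0+vab+vac))
        = (vab*vac*(v0+vab+vac+vbc+v3)^2) / ((v0+vab+vac+vbc+v3)*(v0+vab+vac))^2 := by
      field_simp
    rw [e1, e2, div_pow]
    exact div_le_div_of_nonneg_right hGv (by positivity)
  have h_bc : (v0+vab+vac)/(v0+vab+vac+vbc+v3) ≤ 1 - (vab+vac+v3)/(v0+vab+vac+vbc+v3) := by
    have e1 : 1 - (vab+vac+v3)/(v0+vab+vac+vbc+v3) = (v0+vbc)/(v0+vab+vac+vbc+v3) := by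
      field_simp; ring
    rw [e1]; exact div_le_div_of_nonneg_right (by linarith) hSv.le
  have key := conjF_c_union_mixed_norm
    ((u0+uab+uac)/(u0+uab+uac+ubc+u3)) (uab/(u0+uab+uac)) (uac/(u0+uab+uac)) ((uab+uac+u3)/(u0+uab+uac+ubc+u3))
    ((v0+vab+vac)/(v0+vab+vac+vbc+v3)) (vab/(v0+vab+vac)) (vac/(v0+vab+vac)) ((vab+vac+v3)/(v0+vab+vac+vbc+v3))
    h_y h_yx h_Q h_D h_l h_g h_F h_x' h_xy' h_Q' h_D' h_l' h_g' h_bc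
  -- bridge: the polynomial is (D_uD_vS_uS_v) · Φ
  have bridge : ((u0+uab+uac)*(v0+vab+vac) - (uab*vac+uac*vab))
          * ((u0+uab+uac+ubc+u3)*(v0+vab+vac+vbc+v3) + 2*(u0+ubc)*(v0+vbc)
              - ((uab-uac)*((v0+vab+vac) - (vab+vac)/2) - (vac-vab)*((u0+uab+uac) - (uab+uac)/2)))
        - 3*u0*v0*(u0+uab+uac+ubc+u3)*(v0+vab+vac+vbc+v3)
      = ((u0+uab+uac)*(v0+vab+vac)*(u0+uab+uac+ubc+u3)*(v0+vab+vac+vbc+v3))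
        * ((1 - (uab/(u0+uab+uac)*(vac/(v0+vab+vac)) + uac/(u0+uab+uac)*(vab/(v0+vab+vac))))
            * (1 + 2*(1-(uab+uac+u3)/(u0+uab+uac+ubc+u3))*(1-(vab+vac+v3)/(v0+vab+vac+vbc+v3))
              - (u0+uab+uac)/(u0+uab+uac+ubc+u3)*((v0+vab+vac)/(v0+vab+vac+vbc+v3))
                *((uab/(u0+uab+uac)-uac/(u0+uab+uac))*(1-(vab/(v0+vab+vac)+vac/(v0+vab+vac))/2)
                  - (vac/(v0+vab+vac)-vab/(v0+vab+vac))*(1-(uab/(u0+uab+uac)+uac/(u0+uab+uac))/2)))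
          - 3*(1-(uab/(u0+uab+uac)+uac/(u0+uab+uac)))*(1-(vab/(v0+vab+vac)+vac/(v0+vab+vac)))) := by
    field_simp
    ring
  rw [bridge]
  exact mul_nonneg (by positivity) key

end APL

end Summit.CriticalPhenomena.PercolationContinuityZ3.Theorems
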